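import Summits.Ventures.LatticeQCDFlow.Scaling.HomStarLazyLawFreeFloor

/-!
HONEST FRAMING: exact (Metropolis-corrected) sampling algorithms for lattice gauge theory; figures
of merit are autocorrelation/cost numbers at stated couplings and volumes; no continuum-physics
claim.

# HomStarLazyPooledFloor — FILE 18's LAW-FREE FLOOR FOR THE POOLED LAW, THE LAW CHAPTER AD's CEILING SPEAKS OF: AT `μ_k ≡ ν`, FOR EVERY CONTENT LAW WITH SOME `ν(u) ≤ ½`, THE POOLED
# LAW OF CHAPTER U's HOMOGENEOUS SCHEME FROM `y_u ≡ u` IS AT DISTANCE `> ¼` FROM `Λ_*⊗ν = π_S` WHENEVER `4qn + 4 ≤ n₀′`, SO `t_mix^{pooled}(1/4) > n` — AGAINST AD12's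
# `O((K(t+h)/(t·h·p̄))·log)` THE SAME UNIT `K(t+h)/(th)` AND THE LOGARITHM (lean-2 GEN-45, ours)

Venture-side (OURS).  Cell `lqcd-flow` (pub-lqcd), unit `pub-lqcd-lean-2-g45`, 2026-08-31.  Chapter AE, file 19.  File 18's witness is a composition event, so AD9's lumping
(`homStar_pushforward_lawAt`: the pooled law of the scheme from `y` is `δ_{Λy}S_lⁿ`) carries its mass to the pooled law unchanged (`pushforward_sum_mul`), and the pooled equilibrium
`Λ_*⊗ν` (AD15: `= π_S` under X5's closed form) gives the event at most `⅛`.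

* **`homStar_lazy_pooled_event_mass_ge`**, `homStar_lazy_pooled_equilibrium_mass_le`, **`homStar_lazy_pooled_tvDist_gt_quarter`**, **`homStar_lazy_pooled_lt_mixingTime_piS`**
  (with X5's `π_S`; convergence discharged by X7 ∕ `lazyq_isIrreducible` ∕ LPW 4.9), **`homStar_lazy_pooled_mixingTime_ge_lawFree`** (`t_mix^{pooled}(1/4) ≥ (n₀′ − 4)/(4q)`, as printed).

Reading (no numerics implied): AD12 (`homStar_sharp_pooled_le`): the pooled law is `ε`-close to `π_S` after `(96(c+2K+2)(t+h)/(t·h·p̄))·log(…/ε)` scheme steps; here, at constant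
persistence (`p̄ = ½`): not before `((Kq²/(th) − 1)·log((K+t′)/max{260, 8√(2(K+1))}) − 4)/(4q)` steps, `q = t + h` — the pooled law of the venture's homogeneous scheme is
`Θ((K(t+h)/(th))·log K)` from both sides, for every content law with two or more contents.  NOT CLAIMED: persistence.  Literature grade (cell rule): OWN assembly; no new bib keys.
-/

noncomputable section

open Finset Function
open Literature.Probability.MarkovChains

namespace Summit.Ventures.LatticeQCDFlow.Scaling

section PooledLazy
variable {S : Type*} [Fintype S] [DecidableEq S] {K m : ℕ} (κ : Fin m → Fin K) {ν : S → ℝ} {M : Fin (K + 1) → S → S → ℝ} {w : Fin (K + 1) → ℝ} {t : ℝ} {c : ℕ}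
variable {X : Type*} [Fintype X] [DecidableEq X] {hub : X → S} {comp : X → S → ℕ} {W : S → ℝ} {acc : S → S → ℝ} {Kh : (S → ℕ) → S → S → ℝ}
variable {Ast Bst Sl : X → X → ℝ} {g : (S → ℕ) → ℝ} {πS : X → ℝ} {Z : ℝ}
variable {Λ : (Fin (K + 1) → S) → X}

/-- **THE COMPOSITION EVENT UNDER THE POOLED LAW:** at `μ_k ≡ ν` (`W ≡ 1`), for every `n` with `4qn + 4 ≤ n₀′` (notation of file 18),
**`(δ_{Λy_u}S_lⁿ){x : N_x(u) ≥ (K+1)ν(u) + √(2(K+1))} ≥ 15/32`**. [ours] -/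
theorem homStar_lazy_pooled_event_mass_ge (hm : 1 ≤ m) (ht0 : 0 < t) (ht1 : t < 1) (hK : 2 ≤ K) (hν : ∀ v, 0 < ν v) (hν1 : ∑ v, ν v = 1)
    (hM0 : ∀ u v, M 0 u v = ν v) (hidle : ∀ i : Fin K, ∀ u v, M i.succ u v = if v = u then 1 else 0)
    (hw0 : ∀ k, 0 ≤ w k) (hw00 : 0 < w 0) (hw1 : ∑ k, w k = 1)
    (hunif : ∀ i : Fin K, (univ.filter fun r : Fin m => κ r = i).card = c) (hmc : m = c * K)
    (hWone : ∀ v, W v = 1) (hacc : ∀ h v, acc h v = min 1 (W h / W v))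
    (hKoff : ∀ N h v, h ≠ v → Kh N h v = if N h = 0 then 0 else (N v : ℝ) / K * acc h v) (hKdiag : ∀ N h, Kh N h h = 1 - ∑ v ∈ univ.erase h, Kh N h v)
    (hA : ∀ x x', Ast x x' = if comp x' = comp x then Kh (comp x) (hub x) (hub x') else 0)
    (hB : ∀ x x', Bst x x' = ν (hub x') * (if comp x' + Pi.single (hub x) 1 = comp x + Pi.single (hub x') 1 then 1 else 0))
    (hSl : ∀ x x', Sl x x' = t * Ast x x' + (1 - t) * (w 0 * Bst x x' + (1 - w 0) * (if x = x' then 1 else 0)))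
    (hΛh : ∀ y, hub (Λ y) = y 0) (hΛc : ∀ y v, comp (Λ y) v = (univ.filter fun k : Fin (K + 1) => y k = v).card)
    (hinj : ∀ x x', hub x = hub x' → comp x = comp x' → x = x') (u : S) (hu : ν u ≤ 1 / 2) {n : ℕ}
    (hn : 4 * (t + (1 - t) * w 0) * n + 4 ≤ ((K : ℝ) * (t + (1 - t) * w 0) ^ 2 / (t * ((1 - t) * w 0)) - 1)
        * Real.log (((K : ℝ) + t / (t + (1 - t) * w 0)) / max 260 (8 * Real.sqrt (2 * ((K : ℝ) + 1))))) :
    15 / 32 ≤ ∑ x ∈ univ.filter (fun x : X => ((K : ℝ) + 1) * ν u + Real.sqrt (2 * ((K : ℝ) + 1)) ≤ (comp x u : ℝ)),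
      lawAt Sl (Pi.single (Λ (fun _ : Fin (K + 1) => u)) 1) n x := by
  classical
  have hmass := homStar_lazy_event_mass_ge κ hm ht0 ht1 hK hν hν1 hM0 hidle hw0 hw00 hw1 hunif hmc u hu hn
  set L : (Fin (K + 1) → S) → ℝ := lawAt (fun y z : Fin (K + 1) → S => t * ptGraphSwap (fun _ : Fin (K + 1) => ν)
          (fun r : Fin m => (((0 : Fin (K + 1)), (κ r).succ) : Fin (K + 1) × Fin (K + 1))) (fun _ => Equiv.refl S) y z
          + (1 - t) * prodKernel w M y z) (Pi.single (fun _ : Fin (K + 1) => u) 1) n with hLdef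
  have hμ : ∀ (k : Fin (K + 1)) (x : S), 0 < (fun _ : Fin (K + 1) => ν) k x := fun _ x => hν x
  have hacc' : ∀ a b, acc a b = min 1 ((fun _ : Fin (K + 1) => ν) 0 b * (fun _ : Fin (K + 1) => ν) 1 a / ((fun _ : Fin (K + 1) => ν) 0 a * (fun _ : Fin (K + 1) => ν) 1 b)) := by
    intro a b; rw [hacc, hWone, hWone]; simp only
    rw [div_one, show ν b * ν a / (ν a * ν b) = 1 from by rw [mul_comm]; exact div_self (mul_ne_zero (hν a).ne' (hν b).ne')]
  have hB' : ∀ x x', Bst x x' = (fun _ : Fin (K + 1) => ν) 0 (hub x') * (if comp x' + Pi.single (hub x) 1 = comp x + Pi.single (hub x') 1 then 1 else 0) :=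
    fun x x' => by rw [hB]
  have hpush := homStar_pushforward_lawAt κ (μ := fun _ : Fin (K + 1) => ν) hm hμ (fun _ => rfl) hw1 hM0 hidle hunif hacc' hKoff hKdiag hA hB' hSl hΛh hΛc hinj
    (Pi.single (fun _ : Fin (K + 1) => u) 1) n
  have hδ : (fun x => ∑ y' ∈ univ.filter (fun y' => Λ y' = x), (Pi.single (fun _ : Fin (K + 1) => u) (1 : ℝ) : (Fin (K + 1) → S) → ℝ) y')
      = Pi.single (Λ (fun _ : Fin (K + 1) => u)) 1 := funext fun x => lumping_pushforward_single (fun _ => u) x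
  rw [hδ] at hpush
  have hpush' : ∀ x, ∑ y' ∈ univ.filter (fun y' => Λ y' = x), L y' = lawAt Sl (Pi.single (Λ (fun _ : Fin (K + 1) => u)) 1) n x := fun x => congrFun hpush x
  have hcard : ∀ z : Fin (K + 1) → S, (∑ k, (if z k = u then (1 : ℝ) else 0)) = (comp (Λ z) u : ℝ) := by
    intro z; rw [hΛc, Finset.card_filter]; push_cast; rfl
  have key := pushforward_sum_mul (Λ := Λ) L (fun x => if ((K : ℝ) + 1) * ν u + Real.sqrt (2 * ((K : ℝ) + 1)) ≤ (comp x u : ℝ) then (1 : ℝ) else 0)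
  simp only [hpush'] at key
  have e1 : ∑ x ∈ univ.filter (fun x : X => ((K : ℝ) + 1) * ν u + Real.sqrt (2 * ((K : ℝ) + 1)) ≤ (comp x u : ℝ)), lawAt Sl (Pi.single (Λ (fun _ : Fin (K + 1) => u)) 1) n x
      = ∑ z, L z * (if ((K : ℝ) + 1) * ν u + Real.sqrt (2 * ((K : ℝ) + 1)) ≤ (comp (Λ z) u : ℝ) then (1 : ℝ) else 0) := by
    rw [key, Finset.sum_filter]
    exact sum_congr rfl fun x _ => by split_ifs <;> simp
  have e2 : ∑ z, L z * (if ((K : ℝ) + 1) * ν u + Real.sqrt (2 * ((K : ℝ) + 1)) ≤ (comp (Λ z) u : ℝ) then (1 : ℝ) else 0)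
      = ∑ z ∈ univ.filter (fun z : Fin (K + 1) → S => ((K : ℝ) + 1) * ν u + Real.sqrt (2 * ((K : ℝ) + 1)) ≤ ∑ k, (if z k = u then (1 : ℝ) else 0)), L z := by
    rw [Finset.sum_filter]; refine sum_congr rfl fun z _ => ?_
    rw [← hcard z]; split_ifs <;> simp
  rw [e1, e2, hLdef]; exact hmass

/-- **The pooled equilibrium gives the event at most `⅛`:** `(Λ_*⊗ν){x : N_x(u) ≥ (K+1)ν(u) + √(2(K+1))} ≤ ⅛` (Chebyshev; `ν(u)(1−ν(u)) ≤ ¼`). [ours] -/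
theorem homStar_lazy_pooled_equilibrium_mass_le (hν : ∀ v, 0 < ν v) (hν1 : ∑ v, ν v = 1)
    (hΛc : ∀ y v, comp (Λ y) v = (univ.filter fun k : Fin (K + 1) => y k = v).card) (u : S) :
    ∑ x ∈ univ.filter (fun x : X => ((K : ℝ) + 1) * ν u + Real.sqrt (2 * ((K : ℝ) + 1)) ≤ (comp x u : ℝ)),
      (∑ y ∈ univ.filter (fun y => Λ y = x), tensorFun (fun _ : Fin (K + 1) => ν) y) ≤ 1 / 8 := by
  classical
  have hexc := tensor_count_excess_le (K := K) hν hν1 u (Real.sqrt_pos.mpr (by positivity) : 0 < Real.sqrt (2 * ((K : ℝ) + 1)))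
  have hlam2 : Real.sqrt (2 * ((K : ℝ) + 1)) ^ 2 = 2 * ((K : ℝ) + 1) := Real.sq_sqrt (by positivity)
  have hνu : ν u * (1 - ν u) ≤ 1 / 4 := by nlinarith only [sq_nonneg (ν u - 1 / 2)]
  have hKx := mul_le_mul_of_nonneg_left hνu (by positivity : (0 : ℝ) ≤ (K : ℝ) + 1)
  have hcheb : ((K : ℝ) + 1) * (ν u * (1 - ν u)) / Real.sqrt (2 * ((K : ℝ) + 1)) ^ 2 ≤ 1 / 8 := by
    rw [hlam2, div_le_iff₀ (by positivity)]; linarith only [hKx]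
  have hcard : ∀ z : Fin (K + 1) → S, (∑ k, (if z k = u then (1 : ℝ) else 0)) = (comp (Λ z) u : ℝ) := by
    intro z; rw [hΛc, Finset.card_filter]; push_cast; rfl
  have key := pushforward_sum_mul (Λ := Λ) (tensorFun (fun _ : Fin (K + 1) => ν))
    (fun x => if ((K : ℝ) + 1) * ν u + Real.sqrt (2 * ((K : ℝ) + 1)) ≤ (comp x u : ℝ) then (1 : ℝ) else 0)
  have e1 : ∑ x ∈ univ.filter (fun x : X => ((K : ℝ) + 1) * ν u + Real.sqrt (2 * ((K : ℝ) + 1)) ≤ (comp x u : ℝ)),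
      (∑ y ∈ univ.filter (fun y => Λ y = x), tensorFun (fun _ : Fin (K + 1) => ν) y)
      = ∑ z, tensorFun (fun _ : Fin (K + 1) => ν) z * (if ((K : ℝ) + 1) * ν u + Real.sqrt (2 * ((K : ℝ) + 1)) ≤ (comp (Λ z) u : ℝ) then (1 : ℝ) else 0) := by
    rw [key, Finset.sum_filter]
    exact sum_congr rfl fun x _ => by split_ifs <;> simp
  have e2 : ∑ z, tensorFun (fun _ : Fin (K + 1) => ν) z * (if ((K : ℝ) + 1) * ν u + Real.sqrt (2 * ((K : ℝ) + 1)) ≤ (comp (Λ z) u : ℝ) then (1 : ℝ) else 0)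
      = ∑ z ∈ univ.filter (fun z : Fin (K + 1) → S => ((K : ℝ) + 1) * ν u + Real.sqrt (2 * ((K : ℝ) + 1)) ≤ ∑ k, (if z k = u then (1 : ℝ) else 0)),
          tensorFun (fun _ : Fin (K + 1) => ν) z := by
    rw [Finset.sum_filter]; refine sum_congr rfl fun z _ => ?_
    rw [← hcard z]; split_ifs <;> simp
  rw [e1, e2]; linarith only [hexc, hcheb]

/-- **THE POOLED LAW STAYS `> ¼` AWAY FROM `Λ_*⊗ν` BEFORE `(n₀′ − 4)/(4q)`:** at `μ_k ≡ ν`, for every `n` with `4qn + 4 ≤ n₀′`,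
**`‖δ_{Λy_u}S_lⁿ − Λ_*⊗ν‖_TV > ¼`**. [ours] -/
theorem homStar_lazy_pooled_tvDist_gt_quarter (hm : 1 ≤ m) (ht0 : 0 < t) (ht1 : t < 1) (hK : 2 ≤ K) (hν : ∀ v, 0 < ν v) (hν1 : ∑ v, ν v = 1)
    (hM0 : ∀ u v, M 0 u v = ν v) (hidle : ∀ i : Fin K, ∀ u v, M i.succ u v = if v = u then 1 else 0)
    (hw0 : ∀ k, 0 ≤ w k) (hw00 : 0 < w 0) (hw1 : ∑ k, w k = 1)
    (hunif : ∀ i : Fin K, (univ.filter fun r : Fin m => κ r = i).card = c) (hmc : m = c * K)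
    (hWone : ∀ v, W v = 1) (hacc : ∀ h v, acc h v = min 1 (W h / W v))
    (hKoff : ∀ N h v, h ≠ v → Kh N h v = if N h = 0 then 0 else (N v : ℝ) / K * acc h v) (hKdiag : ∀ N h, Kh N h h = 1 - ∑ v ∈ univ.erase h, Kh N h v)
    (hA : ∀ x x', Ast x x' = if comp x' = comp x then Kh (comp x) (hub x) (hub x') else 0)
    (hB : ∀ x x', Bst x x' = ν (hub x') * (if comp x' + Pi.single (hub x) 1 = comp x + Pi.single (hub x') 1 then 1 else 0))
    (hSl : ∀ x x', Sl x x' = t * Ast x x' + (1 - t) * (w 0 * Bst x x' + (1 - w 0) * (if x = x' then 1 else 0)))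
    (hΛh : ∀ y, hub (Λ y) = y 0) (hΛc : ∀ y v, comp (Λ y) v = (univ.filter fun k : Fin (K + 1) => y k = v).card)
    (hinj : ∀ x x', hub x = hub x' → comp x = comp x' → x = x') (u : S) (hu : ν u ≤ 1 / 2) {n : ℕ}
    (hn : 4 * (t + (1 - t) * w 0) * n + 4 ≤ ((K : ℝ) * (t + (1 - t) * w 0) ^ 2 / (t * ((1 - t) * w 0)) - 1)
        * Real.log (((K : ℝ) + t / (t + (1 - t) * w 0)) / max 260 (8 * Real.sqrt (2 * ((K : ℝ) + 1))))) :
    1 / 4 < tvDist (lawAt Sl (Pi.single (Λ (fun _ : Fin (K + 1) => u)) 1) n) (fun x => ∑ y ∈ univ.filter (fun y => Λ y = x), tensorFun (fun _ : Fin (K + 1) => ν) y) := by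
  classical
  have hmass := homStar_lazy_pooled_event_mass_ge κ hm ht0 ht1 hK hν hν1 hM0 hidle hw0 hw00 hw1 hunif hmc hWone hacc hKoff hKdiag hA hB hSl hΛh hΛc hinj u hu hn
  have hexc := homStar_lazy_pooled_equilibrium_mass_le (Λ := Λ) hν hν1 hΛc u
  -- both laws have unit mass
  have hμ : ∀ (k : Fin (K + 1)) (x : S), 0 < (fun _ : Fin (K + 1) => ν) k x := fun _ x => hν x
  have hacc' : ∀ a b, acc a b = min 1 ((fun _ : Fin (K + 1) => ν) 0 b * (fun _ : Fin (K + 1) => ν) 1 a / ((fun _ : Fin (K + 1) => ν) 0 a * (fun _ : Fin (K + 1) => ν) 1 b)) := by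
    intro a b; rw [hacc, hWone, hWone]; simp only
    rw [div_one, show ν b * ν a / (ν a * ν b) = 1 from by rw [mul_comm]; exact div_self (mul_ne_zero (hν a).ne' (hν b).ne')]
  have hB' : ∀ x x', Bst x x' = (fun _ : Fin (K + 1) => ν) 0 (hub x') * (if comp x' + Pi.single (hub x) 1 = comp x + Pi.single (hub x') 1 then 1 else 0) :=
    fun x x' => by rw [hB]
  have hpush := homStar_pushforward_lawAt κ (μ := fun _ : Fin (K + 1) => ν) hm hμ (fun _ => rfl) hw1 hM0 hidle hunif hacc' hKoff hKdiag hA hB' hSl hΛh hΛc hinj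
    (Pi.single (fun _ : Fin (K + 1) => u) 1) n
  have hδ : (fun x => ∑ y' ∈ univ.filter (fun y' => Λ y' = x), (Pi.single (fun _ : Fin (K + 1) => u) (1 : ℝ) : (Fin (K + 1) → S) → ℝ) y')
      = Pi.single (Λ (fun _ : Fin (K + 1) => u)) 1 := funext fun x => lumping_pushforward_single (fun _ => u) x
  rw [hδ] at hpush
  have hMrs : ∀ k, IsRowStochastic (M k) := by
    intro k
    refine Fin.cases ?_ (fun i => ?_) k
    · exact ⟨fun a b => by rw [hM0]; exact (hν b).le, fun a => by simp_rw [hM0]; exact hν1⟩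
    · refine ⟨fun a b => by rw [hidle]; split_ifs <;> norm_num, fun a => ?_⟩
      simp_rw [hidle]; rw [Finset.sum_ite_eq' univ a]; simp
  have hrow := homStar_tensor_rowsum (K := K) (m := m) (w := w) (t := t) (M := M) hμ (fun _ => hν1) hw0 hw1 hM0 hidle
    (fun r : Fin m => (((0 : Fin (K + 1)), (κ r).succ) : Fin (K + 1) × Fin (K + 1))) (fun _ : Fin m => Equiv.refl S)
  have hPrs : IsRowStochastic (fun y z : Fin (K + 1) → S => t * ptGraphSwap (fun _ : Fin (K + 1) => ν)
          (fun r : Fin m => (((0 : Fin (K + 1)), (κ r).succ) : Fin (K + 1) × Fin (K + 1))) (fun _ => Equiv.refl S) y z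
          + (1 - t) * prodKernel w M y z) := by
    refine ⟨fun y z => ?_, fun y => hrow y⟩
    have h1 := (ptGraphSwap_isRowStochastic (e := fun r : Fin m => (((0 : Fin (K + 1)), (κ r).succ) : Fin (K + 1) × Fin (K + 1))) (φ := fun _ => Equiv.refl S) hμ).1 y z
    have h2 := (prodKernel_isRowStochastic (P := M) (w := w) hw0 hw1 hMrs).1 y z
    exact add_nonneg (mul_nonneg ht0.le h1) (mul_nonneg (by linarith) h2)
  have hl1 : ∑ x, lawAt Sl (Pi.single (Λ (fun _ : Fin (K + 1) => u)) 1) n x = ∑ x, (∑ y ∈ univ.filter (fun y => Λ y = x), tensorFun (fun _ : Fin (K + 1) => ν) y) := by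
    rw [← hpush]
    have k1 := pushforward_sum_mul (Λ := Λ) (lawAt (fun y z : Fin (K + 1) → S => t * ptGraphSwap (fun _ : Fin (K + 1) => ν)
          (fun r : Fin m => (((0 : Fin (K + 1)), (κ r).succ) : Fin (K + 1) × Fin (K + 1))) (fun _ => Equiv.refl S) y z
          + (1 - t) * prodKernel w M y z) (Pi.single (fun _ : Fin (K + 1) => u) 1) n) (fun _ => 1)
    have k2 := pushforward_sum_mul (Λ := Λ) (tensorFun (fun _ : Fin (K + 1) => ν)) (fun _ => 1)
    simp only [mul_one] at k1 k2
    rw [← k1, ← k2, sum_lawAt hPrs, Finset.sum_pi_single', if_pos (mem_univ _), sum_tensorFun_eq_one (fun _ : Fin (K + 1) => ν) (fun _ => hν1)]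
  have htv := sub_sum_le_tvDist hl1 (univ.filter (fun x : X => ((K : ℝ) + 1) * ν u + Real.sqrt (2 * ((K : ℝ) + 1)) ≤ (comp x u : ℝ)))
  linarith only [hmass, hexc, htv]

/-- **NOT BEFORE `(n₀′ − 4)/(4q)` FOR THE POOLED LAW AGAINST X5's `π_S`, UNCONDITIONALLY IN THE CHAIN:** under X5's closed form for `π_S` (`= Λ_*⊗ν`, AD15), every `n` with
`4qn + 4 ≤ n₀′` has **`n < t_mix^{pooled}(1/4)`** (convergence discharged: X7's irreducibility, AD's `lazyq_isIrreducible`, LPW 4.9) — AD12's ceiling for the same law is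
`O((K(t+h)/(t·h·p̄))·log)`. [ours] -/
theorem homStar_lazy_pooled_lt_mixingTime_piS [Nonempty X] (hm : 1 ≤ m) (ht0 : 0 < t) (ht1 : t < 1) (hK : 2 ≤ K) (hν : ∀ v, 0 < ν v) (hν1 : ∑ v, ν v = 1)
    (hM0 : ∀ u v, M 0 u v = ν v) (hidle : ∀ i : Fin K, ∀ u v, M i.succ u v = if v = u then 1 else 0)
    (hw0 : ∀ k, 0 ≤ w k) (hw00 : 0 < w 0) (hw1 : ∑ k, w k = 1)
    (hunif : ∀ i : Fin K, (univ.filter fun r : Fin m => κ r = i).card = c) (hmc : m = c * K)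
    (hWone : ∀ v, W v = 1) (hacc : ∀ h v, acc h v = min 1 (W h / W v)) (hinj : ∀ x x', hub x = hub x' → comp x = comp x' → x = x')
    (hsum : ∀ x, ∑ v, comp x v = K + 1) (hsurj : ∀ (z : S) (N : S → ℕ), ∑ v, N v = K + 1 → N z ≠ 0 → ∃ x, hub x = z ∧ comp x = N) (hhub : ∀ x, comp x (hub x) ≠ 0)
    (hKoff : ∀ N h v, h ≠ v → Kh N h v = if N h = 0 then 0 else (N v : ℝ) / K * acc h v) (hKdiag : ∀ N h, Kh N h h = 1 - ∑ v ∈ univ.erase h, Kh N h v)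
    (hA : ∀ x x', Ast x x' = if comp x' = comp x then Kh (comp x) (hub x) (hub x') else 0)
    (hB : ∀ x x', Bst x x' = ν (hub x') * (if comp x' + Pi.single (hub x) 1 = comp x + Pi.single (hub x') 1 then 1 else 0))
    (hSl : ∀ x x', Sl x x' = t * Ast x x' + (1 - t) * (w 0 * Bst x x' + (1 - w 0) * (if x = x' then 1 else 0)))
    (hg : ∀ N, g N = ∏ v, (ν v * W v) ^ (N v) / ((N v).factorial : ℝ))
    (hZ : Z = ∑ x, g (comp x) * ((comp x (hub x) : ℝ) / W (hub x))) (hπS : ∀ x, πS x = g (comp x) * ((comp x (hub x) : ℝ) / W (hub x)) / Z)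
    (hΛh : ∀ y, hub (Λ y) = y 0) (hΛc : ∀ y v, comp (Λ y) v = (univ.filter fun k : Fin (K + 1) => y k = v).card)
    (u : S) (hu : ν u ≤ 1 / 2) {n : ℕ}
    (hn : 4 * (t + (1 - t) * w 0) * n + 4 ≤ ((K : ℝ) * (t + (1 - t) * w 0) ^ 2 / (t * ((1 - t) * w 0)) - 1)
        * Real.log (((K : ℝ) + t / (t + (1 - t) * w 0)) / max 260 (8 * Real.sqrt (2 * ((K : ℝ) + 1))))) :
    n < mixingTime Sl πS (1 / 4) := by
  classical
  have hq := homStar_lazy_pooled_tvDist_gt_quarter κ hm ht0 ht1 hK hν hν1 hM0 hidle hw0 hw00 hw1 hunif hmc hWone hacc hKoff hKdiag hA hB hSl hΛh hΛc hinj u hu hn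
  have hμ : ∀ (k : Fin (K + 1)) (x : S), 0 < (fun _ : Fin (K + 1) => ν) k x := fun _ x => hν x
  have hWdef : ∀ v, W v = (fun _ : Fin (K + 1) => ν) 1 v / (fun _ : Fin (K + 1) => ν) 0 v := fun v => by rw [hWone]; simp only; rw [div_self (hν v).ne']
  have hB' : ∀ x x', Bst x x' = (fun _ : Fin (K + 1) => ν) 0 (hub x') * (if comp x' + Pi.single (hub x) 1 = comp x + Pi.single (hub x') 1 then 1 else 0) :=
    fun x x' => by rw [hB]
  have hg' : ∀ N, g N = ∏ v, ((fun _ : Fin (K + 1) => ν) 0 v * W v) ^ (N v) / ((N v).factorial : ℝ) := fun N => by rw [hg]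
  have hπ : ∀ x, πS x = ∑ y ∈ univ.filter (fun y => Λ y = x), tensorFun (fun _ : Fin (K + 1) => ν) y := fun x =>
    homStar_piS_eq_pushforward κ (μ := fun _ : Fin (K + 1) => ν) hm hμ (fun _ => hν1) (fun _ => rfl) hw0 hw00 hw1 ht0 ht1 hM0 hidle hunif hWdef hinj hsum hsurj hhub
      (by omega) hacc hKoff hKdiag hA hB' hSl hg' hZ hπS hΛh hΛc x
  have hπfun : πS = fun x => ∑ y ∈ univ.filter (fun y => Λ y = x), tensorFun (fun _ : Fin (K + 1) => ν) y := funext hπ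
  -- row-stochasticity of `S_l` (X5) and stationarity of `π_S` (AD15)
  have hW' : ∀ v, 0 < W v := fun v => by rw [hWone]; norm_num
  have hA0 : ∀ x x', 0 ≤ Ast x x' := starStep_swap_nonneg hW' hacc (by omega) hsum hKoff hKdiag hA
  have hA1 : ∀ x, ∑ x', Ast x x' = 1 := starStep_swap_rowsum hinj hsurj hhub hsum hKoff hKdiag hA
  have hB0 : ∀ x x', 0 ≤ Bst x x' := fun x x' => by rw [hB]; exact mul_nonneg (hν _).le (by split_ifs <;> norm_num)
  have hB1 : ∀ x, ∑ x', Bst x x' = 1 := starStep_redraw_rowsum hinj hsurj hhub hsum hν1 hB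
  have hw01 : w 0 ≤ 1 := by
    calc w 0 ≤ ∑ k, w k := single_le_sum (fun k _ => hw0 k) (mem_univ 0)
      _ = 1 := hw1
  have hSlrs : IsRowStochastic Sl := by
    refine ⟨fun x x' => ?_, fun x => ?_⟩
    · rw [hSl]
      exact add_nonneg (mul_nonneg ht0.le (hA0 x x'))
        (mul_nonneg (by linarith) (add_nonneg (mul_nonneg (hw0 0) (hB0 x x')) (mul_nonneg (by linarith) (by split_ifs <;> norm_num))))
    · simp_rw [hSl]
      rw [sum_add_distrib, ← mul_sum, hA1, ← mul_sum, sum_add_distrib, ← mul_sum, hB1, ← mul_sum]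
      rw [Finset.sum_ite_eq univ x, if_pos (mem_univ _)]; ring
  have hacc' : ∀ a b, acc a b = min 1 ((fun _ : Fin (K + 1) => ν) 0 b * (fun _ : Fin (K + 1) => ν) 1 a / ((fun _ : Fin (K + 1) => ν) 0 a * (fun _ : Fin (K + 1) => ν) 1 b)) := by
    intro a b; rw [hacc, hWone, hWone]; simp only
    rw [div_one, show ν b * ν a / (ν a * ν b) = 1 from by rw [mul_comm]; exact div_self (mul_ne_zero (hν a).ne' (hν b).ne')]
  have hst := homStar_pushforward_isStationary κ (μ := fun _ : Fin (K + 1) => ν) hm hμ (fun _ => hν1) (fun _ => rfl) hw0 hw1 hM0 hidle hunif hacc' hKoff hKdiag hA hB' hSl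
    hΛh hΛc hinj
  rw [← hπfun] at hst hq
  -- convergence: `S_l = q·S' + (1−q)·I` for X5's step chain `S'` at swap odds `t/q` (X7: irreducible; aperiodic by the redraw diagonal; LPW 4.9)
  have h1t : 0 < 1 - t := by linarith
  have hq0 : 0 < t + (1 - t) * w 0 := by nlinarith
  have hσ0 : 0 < t / (t + (1 - t) * w 0) := div_pos ht0 hq0
  have hσ1 : t / (t + (1 - t) * w 0) < 1 := by rw [div_lt_one hq0]; nlinarith
  obtain ⟨Sst, hSst⟩ : ∃ Sst : X → X → ℝ, ∀ x x', Sst x x' = t / (t + (1 - t) * w 0) * Ast x x' + (1 - t / (t + (1 - t) * w 0)) * Bst x x' :=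
    ⟨fun x x' => t / (t + (1 - t) * w 0) * Ast x x' + (1 - t / (t + (1 - t) * w 0)) * Bst x x', fun _ _ => rfl⟩
  have hSl' : ∀ x x', Sl x x' = (t + (1 - t) * w 0) * Sst x x' + (1 - (t + (1 - t) * w 0)) * (if x = x' then 1 else 0) := by
    intro x x'; rw [hSl, hSst]; field_simp; ring
  have hS0 : ∀ x x', 0 ≤ Sst x x' := fun x x' => by rw [hSst]; exact add_nonneg (mul_nonneg hσ0.le (hA0 x x')) (mul_nonneg (by linarith) (hB0 x x'))
  have hirrS := lumpedStar_step_irreducible hsurj hhub hW' hacc (by omega) hsum hKoff hKdiag hν hσ0 hσ1 hA hB hSst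
  have hirr := lazyq_isIrreducible (S := Sst) hS0 hq0 (by nlinarith) hSl' hirrS
  have hap : IsAperiodic Sl := isAperiodic_of_diag_pos fun x => by
    rw [hSl]
    have hBxx : Bst x x = ν (hub x) := by rw [hB, if_pos rfl, mul_one]
    have h1 : 0 < (1 - t) * (w 0 * Bst x x + (1 - w 0) * (if x = x then (1 : ℝ) else 0)) := by
      rw [if_pos rfl, hBxx]; exact mul_pos h1t (by nlinarith [hν (hub x), hw0 0])
    have h2 := mul_nonneg ht0.le (hA0 x x)
    linarith
  have hπpos := lumpedStar_piS_pos hhub hW' hν hg hZ hπS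
  have hπ1 := lumpedStar_piS_sum hhub hW' hν hg hZ hπS
  have hmix : ∃ t₀, worstTvDist Sl πS t₀ ≤ 1 / 4 := exists_worstTvDist_le hSlrs hirr hap hst (fun x => (hπpos x).le) hπ1 (by norm_num)
  by_contra h
  push Not at h
  obtain ⟨t₀, ht₀⟩ := hmix
  have hd := worstTvDist_le_of_mixingTime_le hSlrs hst ht₀ h
  have hw' := tvDist_single_le_worstTvDist Sl πS n (Λ (fun _ : Fin (K + 1) => u))
  linarith

/-- **THE LAW-FREE FLOOR FOR THE POOLED LAW OF THE VENTURE's HOMOGENEOUS SCHEME, as printed:** at `μ_k ≡ ν`, for every content law `ν > 0` with some `ν(u) ≤ ½`, unconditionally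
in the chain, **`t_mix^{pooled}(1/4) ≥ (n₀′ − 4)/(4q)`**, `q = t + (1−t)w_0`, `n₀′ = (Kq²/(t(1−t)w_0) − 1)·log((K + t/q)/max{260, 8√(2(K+1))})` — against AD12's
`(96(c+2K+2)(t+h)/(t·h·p̄))·log(…/ε)` for the same law. [ours] -/
theorem homStar_lazy_pooled_mixingTime_ge_lawFree [Nonempty X] (hm : 1 ≤ m) (ht0 : 0 < t) (ht1 : t < 1) (hK : 2 ≤ K) (hν : ∀ v, 0 < ν v) (hν1 : ∑ v, ν v = 1)
    (hM0 : ∀ u v, M 0 u v = ν v) (hidle : ∀ i : Fin K, ∀ u v, M i.succ u v = if v = u then 1 else 0)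
    (hw0 : ∀ k, 0 ≤ w k) (hw00 : 0 < w 0) (hw1 : ∑ k, w k = 1)
    (hunif : ∀ i : Fin K, (univ.filter fun r : Fin m => κ r = i).card = c) (hmc : m = c * K)
    (hWone : ∀ v, W v = 1) (hacc : ∀ h v, acc h v = min 1 (W h / W v)) (hinj : ∀ x x', hub x = hub x' → comp x = comp x' → x = x')
    (hsum : ∀ x, ∑ v, comp x v = K + 1) (hsurj : ∀ (z : S) (N : S → ℕ), ∑ v, N v = K + 1 → N z ≠ 0 → ∃ x, hub x = z ∧ comp x = N) (hhub : ∀ x, comp x (hub x) ≠ 0)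
    (hKoff : ∀ N h v, h ≠ v → Kh N h v = if N h = 0 then 0 else (N v : ℝ) / K * acc h v) (hKdiag : ∀ N h, Kh N h h = 1 - ∑ v ∈ univ.erase h, Kh N h v)
    (hA : ∀ x x', Ast x x' = if comp x' = comp x then Kh (comp x) (hub x) (hub x') else 0)
    (hB : ∀ x x', Bst x x' = ν (hub x') * (if comp x' + Pi.single (hub x) 1 = comp x + Pi.single (hub x') 1 then 1 else 0))
    (hSl : ∀ x x', Sl x x' = t * Ast x x' + (1 - t) * (w 0 * Bst x x' + (1 - w 0) * (if x = x' then 1 else 0)))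
    (hg : ∀ N, g N = ∏ v, (ν v * W v) ^ (N v) / ((N v).factorial : ℝ))
    (hZ : Z = ∑ x, g (comp x) * ((comp x (hub x) : ℝ) / W (hub x))) (hπS : ∀ x, πS x = g (comp x) * ((comp x (hub x) : ℝ) / W (hub x)) / Z)
    (hΛh : ∀ y, hub (Λ y) = y 0) (hΛc : ∀ y v, comp (Λ y) v = (univ.filter fun k : Fin (K + 1) => y k = v).card)
    (u : S) (hu : ν u ≤ 1 / 2) :
    ((((K : ℝ) * (t + (1 - t) * w 0) ^ 2 / (t * ((1 - t) * w 0)) - 1)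
        * Real.log (((K : ℝ) + t / (t + (1 - t) * w 0)) / max 260 (8 * Real.sqrt (2 * ((K : ℝ) + 1))))) - 4) / (4 * (t + (1 - t) * w 0))
      ≤ (mixingTime Sl πS (1 / 4) : ℝ) := by
  classical
  set q : ℝ := t + (1 - t) * w 0 with hqdef
  have hq0 : 0 < q := by rw [hqdef]; nlinarith
  set n₀ : ℝ := ((K : ℝ) * q ^ 2 / (t * ((1 - t) * w 0)) - 1) * Real.log (((K : ℝ) + t / q) / max 260 (8 * Real.sqrt (2 * ((K : ℝ) + 1)))) with hn₀def
  by_cases h4 : n₀ < 4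
  · calc (n₀ - 4) / (4 * q) ≤ 0 := div_nonpos_of_nonpos_of_nonneg (by linarith) (by linarith)
      _ ≤ _ := Nat.cast_nonneg _
  push Not at h4
  set n : ℕ := ⌊(n₀ - 4) / (4 * q)⌋₊ with hndef
  have hnle : (n : ℝ) ≤ (n₀ - 4) / (4 * q) := Nat.floor_le (div_nonneg (by linarith) (by linarith))
  have hnlt : (n₀ - 4) / (4 * q) < n + 1 := Nat.lt_floor_add_one _
  have hn : 4 * q * n + 4 ≤ n₀ := by rw [le_div_iff₀ (by linarith)] at hnle; linarith
  have hlt := homStar_lazy_pooled_lt_mixingTime_piS κ hm ht0 ht1 hK hν hν1 hM0 hidle hw0 hw00 hw1 hunif hmc hWone hacc hinj hsum hsurj hhub hKoff hKdiag hA hB hSl hg hZ hπS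
    hΛh hΛc u hu hn
  have hcast : (n : ℝ) + 1 ≤ (mixingTime Sl πS (1 / 4) : ℝ) := by exact_mod_cast hlt
  linarith
end PooledLazy

end Summit.Ventures.LatticeQCDFlow.Scaling

end
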